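import Literature.NumberTheory.GaloisRepresentations.LocalWeilDatumExtensionGalois
import Literature.NumberTheory.GaloisRepresentations.LocalFieldFiniteExtensionIntegers
import Literature.NumberTheory.GaloisRepresentations.IntegralGaloisAction
import Literature.NumberTheory.GaloisRepresentations.AbsGaloisGroupOpenNormal
import Mathlib.FieldTheory.Galois.Infinite
import HarnessLib

/-!
# Finite Galois levels `L ⊆ K̄` as inputs to the level transport ([AbsAnab] Prop 1.2.1 (vii), step 4a)

Proof-only companion (abc-iut layer L4, sub-node `AbsAnab:Prop1.2.1(vii)/L02 UnitsTransport`).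
S. Mochizuki, *The Absolute Anabelian Geometry of Hyperbolic Curves* (2004) [AbsAnab], proof of
Prop 1.2.1 p. 11: "given an open subgroup `H ⊆ G_{Kᵢ}` (…) corresponding to extensions
`K₁ ⊆ L₁ ⊆ K̄₁`, `K₂ ⊆ L₂ ⊆ K̄₂`" — the bookkeeping that lets the level isomorphisms
`ψ_E : E₁⁰ˣ ⥲ E₂⁰ˣ` (`AbsAnabLevelTransportProofs`) be indexed by the finite Galois subextensions
`L ⊆ K̄₁` and assembled over `K̄₁ = ⋃ L`:

* `embField_coe_eq_self` — a normal `L ⊆ K̄` is its own copy `ι⁻¹(L)` used by the Weil datum;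
* `exists_partner_level` — for `L/K₁` finite Galois, the finite Galois `M/K₂` with
  `α(Gal(K̄₁/L)) = Gal(K̄₂/M)` ("corresponding to extensions `K₂ ⊆ L₂`");
* `le_of_galFixing_le`, `exists_level_mem`, `exists_level_ge` — Galois correspondence / cofinality;
* `coe_mem_absIntegers_iff_map_mem_unitGroup` — "`𝒪^×`": an element of a finite level is an absolute
  unit (it and its inverse integral over `𝒪_K`) iff it is a unit of the prolonged valuation
  (Serre, *Local Fields* II §2 Prop. 3);
* `mem_galFixing_embField_self`, `coe_embField_self`, `embField_self_le` — the bottom level `E = K`.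

No definitions, no new named facts.  HONEST FRAMING: nothing here bears on [IUTchIII] Cor. 3.12.
-/

noncomputable section

open Field ValuativeRel
open scoped Pointwise

namespace Literature.AnabelianGeometry.AbsoluteAnabelian

open Literature.NumberTheory.GaloisRepresentations
open Literature.NumberTheory.GaloisRepresentations.LocalWeilDatum

/-! ### A normal `L ⊆ K̄` is its own `ι⁻¹(L)` -/

section Self

variable {K : Type*} [Field K]

/-- For a normal intermediate field `L` of `K̄/K`, the copy `ι⁻¹(L) ⊆ K̄` of `L` used by the Weil
datum (`embField K L`, `ι : K̄ ≅ L̄` the chosen `K`-embedding) is `L` itself (all `K`-embeddings of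
a normal `L` into `K̄` have image `L`).  (Same statement as the private `embField_eq_self` of
`MLFReciprocityEquivariantProofs`, abc-iut-L6-t11.) [cite: MochizukiAbsAnab2004, Prop 1.2.1 (vii) p.11] -/
theorem embField_coe_eq_self (L : IntermediateField K (AlgebraicClosure K)) [Normal K L] :
    embField K L = L := by
  ext a
  rw [mem_embField_iff]
  constructor
  · rintro ⟨y, hy⟩
    obtain ⟨x, rfl⟩ := ((absClosureEmbedding K L).restrictNormal' L).surjective y
    have hx : algebraMap L (AlgebraicClosure L) ((absClosureEmbedding K L).restrictNormal' L x) =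
        absClosureEmbedding K L (x : AlgebraicClosure K) :=
      (absClosureEmbedding K L).restrictNormal_commutes L x
    rw [hx] at hy
    rw [← (absClosureEmbedding K L).injective hy]
    exact x.2
  · intro ha
    exact ⟨(absClosureEmbedding K L).restrictNormal' L ⟨a, ha⟩,
      (absClosureEmbedding K L).restrictNormal_commutes L ⟨a, ha⟩⟩

/-- Membership form of `embField_coe_eq_self`. [cite: MochizukiAbsAnab2004, Prop 1.2.1 (vii) p.11] -/
theorem mem_embField_coe_iff (L : IntermediateField K (AlgebraicClosure K)) [Normal K L]
    {a : AlgebraicClosure K} : a ∈ embField K L ↔ a ∈ L := by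
  rw [embField_coe_eq_self]

/-- `Gal(K̄/ι⁻¹(L)) = Gal(K̄/L)` for normal `L`. [cite: MochizukiAbsAnab2004, Prop 1.2.1 (vii) p.11] -/
theorem mem_galFixing_embField_coe_iff (L : IntermediateField K (AlgebraicClosure K)) [Normal K L]
    {g : absoluteGaloisGroup K} : g ∈ galFixing K (embField K L) ↔ g ∈ galFixing K L := by
  rw [embField_coe_eq_self]

/-- `L ≤ L'` gives `ι⁻¹(L) ≤ ι'⁻¹(L')` for normal `L, L'`. [cite: MochizukiAbsAnab2004, Prop 1.2.1 (vii) p.11] -/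
theorem embField_coe_le_of_le {L L' : IntermediateField K (AlgebraicClosure K)} [Normal K L]
    [Normal K L'] (h : L ≤ L') : embField K L ≤ embField K L' := by
  rw [embField_coe_eq_self, embField_coe_eq_self]
  exact h

/-! ### The bottom level `E = K` -/

/-- Every element of `Γ_K` fixes `ι⁻¹(K) ⊆ K̄` (the image of `K`): `Gal(K̄/ι⁻¹(K)) = Γ_K`.
[cite: MochizukiAbsAnab2004, Prop 1.2.1 (vii) p.11] -/
theorem coe_embField_self (a : embField K K) :
    (a : AlgebraicClosure K) = algebraMap K (AlgebraicClosure K) ((equivEmbField K K).symm a) := by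
  have h := absClosureEmbedding_coe_eq K K a
  rw [← (absClosureEmbedding K K).commutes ((equivEmbField K K).symm a)] at h
  exact (absClosureEmbedding K K).injective h

/-- `ι⁻¹(K)` is contained in every intermediate field. [cite: MochizukiAbsAnab2004, Prop 1.2.1 (vii) p.11] -/
theorem embField_self_le (M : IntermediateField K (AlgebraicClosure K)) : embField K K ≤ M := by
  intro a ha
  rw [show a = _ from coe_embField_self (⟨a, ha⟩ : embField K K)]
  exact M.algebraMap_mem _

/-- `Gal(K̄/ι⁻¹(K)) = Γ_K`. [cite: MochizukiAbsAnab2004, Prop 1.2.1 (vii) p.11] -/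
theorem mem_galFixing_embField_self (g : absoluteGaloisGroup K) : g ∈ galFixing K (embField K K) := by
  rw [mem_galFixing_iff]
  intro a ha
  rw [show a = _ from coe_embField_self (⟨a, ha⟩ : embField K K)]
  exact smul_algebraMap g _

end Self

/-! ### Partner levels and the Galois correspondence -/

section Partner

variable {K₁ K₂ : Type*} [Field K₁] [CharZero K₁] [Field K₂]

/-- **The partner level** ([AbsAnab] proof of Prop 1.2.1 p. 11: an open subgroup
`G_{L₁} = H ⊆ G_{K₁}` and its image correspond to finite extensions `K₁ ⊆ L₁`, `K₂ ⊆ L₂`): for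
`α : Γ_{K₁} ≅ Γ_{K₂}` and a finite Galois `L ⊆ K̄₁` there is a finite Galois `M ⊆ K̄₂` with
`g ∈ Gal(K̄₁/L) ↔ α g ∈ Gal(K̄₂/M)` — the fixed field of the open normal subgroup `α(Gal(K̄₁/L))`
(`exists_isGalois_fixingSubgroup_eq`). [cite: MochizukiAbsAnab2004, Prop 1.2.1 (iii) p.11] -/
theorem exists_partner_level (α : absoluteGaloisGroup K₁ ≃ₜ* absoluteGaloisGroup K₂)
    (L : IntermediateField K₁ (AlgebraicClosure K₁)) [FiniteDimensional K₁ L] [IsGalois K₁ L] :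
    ∃ M : IntermediateField K₂ (AlgebraicClosure K₂), FiniteDimensional K₂ M ∧ IsGalois K₂ M ∧
      ∀ g : absoluteGaloisGroup K₁, g ∈ galFixing K₁ L ↔ α g ∈ galFixing K₂ M := by
  -- `Gal(K̄₁/L)` is open and normal, hence so is its image under `α`
  have hnormal : (galFixing K₁ L).Normal :=
    Subgroup.Normal.comap ((InfiniteGalois.normal_iff_isGalois L).mpr inferInstance) _
  let N : Subgroup (absoluteGaloisGroup K₂) := (galFixing K₁ L).map α.toMulEquiv.toMonoidHom
  have hN : N.Normal := Subgroup.Normal.map hnormal _ α.surjective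
  have hNopen : IsOpen (N : Set (absoluteGaloisGroup K₂)) := by
    rw [Subgroup.coe_map]
    exact α.toHomeomorph.isOpenMap _ (isOpen_galFixing K₁ L)
  have hmemN : ∀ g : absoluteGaloisGroup K₁, g ∈ galFixing K₁ L ↔ α g ∈ N := fun g =>
    ⟨fun hg => ⟨g, hg, rfl⟩, fun ⟨h, hh, hhg⟩ => by rwa [← α.injective hhg]⟩
  -- its fixed field
  let N' : Subgroup (AlgebraicClosure K₂ ≃ₐ[K₂] AlgebraicClosure K₂) :=
    N.map (absoluteGaloisGroup.toAlgEquiv K₂).toMonoidHom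
  have hN'set : (N' : Set (AlgebraicClosure K₂ ≃ₐ[K₂] AlgebraicClosure K₂)) =
      (N : Set (absoluteGaloisGroup K₂)) :=
    Set.ext fun g => ⟨fun ⟨h, hh, hhg⟩ => hhg ▸ hh, fun hg => ⟨g, hg, rfl⟩⟩
  obtain ⟨M, hM₁, hM₂, hM₃⟩ := exists_isGalois_fixingSubgroup_eq (F := K₂)
    (E := AlgebraicClosure K₂) N'
    (hU := Subgroup.Normal.map hN _ (absoluteGaloisGroup.toAlgEquiv K₂).surjective)
    (by rw [hN'set]; exact hNopen)
  refine ⟨M, hM₁, hM₂, fun g => ?_⟩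
  rw [hmemN]
  change α g ∈ N ↔ absoluteGaloisGroup.toAlgEquiv K₂ (α g) ∈ M.fixingSubgroup
  rw [hM₃]
  exact (Set.ext_iff.mp hN'set (α g)).symm

variable [CharZero K₂]

omit [CharZero K₁] in
/-- Galois correspondence: `Gal(K̄/M') ≤ Gal(K̄/M) ⇒ M ≤ M'`. [cite: MochizukiAbsAnab2004, Prop 1.2.1 (vii) p.11] -/
theorem le_of_galFixing_le {M M' : IntermediateField K₂ (AlgebraicClosure K₂)}
    (h : galFixing K₂ M' ≤ galFixing K₂ M) : M ≤ M' := by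
  rw [← InfiniteGalois.fixedField_fixingSubgroup M, ← InfiniteGalois.fixedField_fixingSubgroup M']
  apply IntermediateField.fixedField_le
  intro σ hσ
  have : (absoluteGaloisGroup.toAlgEquiv K₂).symm σ ∈ galFixing K₂ M' := by
    rw [galFixing, Subgroup.mem_comap]
    simpa using hσ
  have h' := h this
  rw [galFixing, Subgroup.mem_comap] at h'
  simpa using h'

end Partner

/-! ### Cofinality of the finite Galois levels -/

section Levels

variable {K : Type*} [Field K] [CharZero K]

/-- Every element of `K̄` lies in a finite Galois subextension (the normal closure of `K(x)`).
[cite: MochizukiAbsAnab2004, Prop 1.2.1 (vii) p.11] -/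
theorem exists_level_mem (x : AlgebraicClosure K) :
    ∃ L : IntermediateField K (AlgebraicClosure K), FiniteDimensional K L ∧ IsGalois K L ∧ x ∈ L := by
  have hx : IsIntegral K x := (Algebra.IsAlgebraic.isAlgebraic (R := K) x).isIntegral
  haveI := IntermediateField.adjoin.finiteDimensional hx
  let L := IntermediateField.normalClosure K (IntermediateField.adjoin K {x}) (AlgebraicClosure K)
  haveI : FiniteDimensional K L :=
    normalClosure.is_finiteDimensional K (IntermediateField.adjoin K {x}) (AlgebraicClosure K)
  haveI : Normal K L := normalClosure.normal K (IntermediateField.adjoin K {x}) (AlgebraicClosure K)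
  haveI : IsGalois K L := IsGalois.mk
  exact ⟨L, inferInstance, inferInstance,
    IntermediateField.le_normalClosure _ (IntermediateField.mem_adjoin_simple_self K x)⟩

/-- Two finite Galois levels have a common finite Galois upper bound (the normal closure of the
compositum). [cite: MochizukiAbsAnab2004, Prop 1.2.1 (vii) p.11] -/
theorem exists_level_ge (L L' : IntermediateField K (AlgebraicClosure K)) [FiniteDimensional K L]
    [FiniteDimensional K L'] :
    ∃ L'' : IntermediateField K (AlgebraicClosure K), FiniteDimensional K L'' ∧ IsGalois K L'' ∧
      L ≤ L'' ∧ L' ≤ L'' := by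
  let M := IntermediateField.normalClosure K (↥(L ⊔ L')) (AlgebraicClosure K)
  haveI : FiniteDimensional K M := normalClosure.is_finiteDimensional K (↥(L ⊔ L')) (AlgebraicClosure K)
  haveI : Normal K M := normalClosure.normal K (↥(L ⊔ L')) (AlgebraicClosure K)
  haveI : IsGalois K M := IsGalois.mk
  exact ⟨M, inferInstance, inferInstance, le_sup_left.trans (IntermediateField.le_normalClosure _),
    le_sup_right.trans (IntermediateField.le_normalClosure _)⟩

end Levels

/-! ### Absolute units and units of a finite level -/

section Units

variable (K : Type*) [Field K] [ValuativeRel K] [TopologicalSpace K] [IsNonarchimedeanLocalField K]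
  (E : Type*) [Field E] [Algebra K E] [FiniteDimensional K E]

/-- **"`Im(𝒪^×)`" at a finite level**: for `u ∈ ι⁻¹(E)ˣ ⊆ K̄ˣ`, `u` and `u⁻¹` are integral over
`𝒪_K` (absolute units, `absIntegers`) iff `ι u` is a unit of the ring of integers of the local
field `E` (prolonged valuation) — the ring of integers of `E` is the integral closure of `𝒪_K`
(Serre, *Local Fields* II §2 Prop. 3). [cite: MochizukiAbsAnab2004, Prop 1.2.1 (iii) p.10] -/
theorem coe_mem_absIntegers_iff_map_mem_unitGroup (u : (embField K E)ˣ) :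
    letI := FiniteExtension.valuativeRel K E
    (((u : embField K E) : AlgebraicClosure K) ∈ absIntegers 𝒪[K] K ∧
        ((↑u⁻¹ : embField K E) : AlgebraicClosure K) ∈ absIntegers 𝒪[K] K) ↔
      Units.map ((equivEmbField K E).symm : embField K E →* E) u ∈
        (valuation E).valuationSubring.unitGroup := by
  letI := FiniteExtension.valuativeRel K E
  have hne : ((Units.map ((equivEmbField K E).symm : embField K E →* E) u : Eˣ) : E) ≠ 0 :=
    Units.ne_zero _
  rw [Valuation.mem_unitGroup_iff,
    FiniteExtension.valuation_eq_one_iff_isIntegral_and_isIntegral_inv K E hne,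
    ← Units.val_inv_eq_inv_val, ← map_inv, Units.coe_map, Units.coe_map, MonoidHom.coe_coe]
  have h1 : ∀ z : embField K E, IsIntegral 𝒪[K] ((equivEmbField K E).symm z) ↔
      (z : AlgebraicClosure K) ∈ absIntegers 𝒪[K] K := fun z => by
    rw [show ((equivEmbField K E).symm z : E) = ((equivEmbField K E).symm.restrictScalars 𝒪[K]) z
      from rfl, isIntegral_algEquiv, absIntegers, mem_integralClosure_iff,
      ← isIntegral_algHom_iff ((embField K E).val.restrictScalars 𝒪[K]) Subtype.val_injective]
    rfl
  rw [h1, h1]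

end Units

end Literature.AnabelianGeometry.AbsoluteAnabelian
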